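import Mathlib
import HarnessLib
import Summits.Ventures.LatticeQCDFlow.Scaling.GeneralLayerDissipation
import Summits.Ventures.LatticeQCDFlow.Scaling.BlockDefect
import Summits.Ventures.LatticeQCDFlow.Scaling.HierarchicalVolumeLawExact
import Summits.Ventures.LatticeQCDFlow.Scaling.StochasticFlows

/-!
# EntropyLagLaw — the lag law for arbitrary relaxation layers by the RELATIVE-ENTROPY route:
# `|⟨W⟩ − ΔF − KL_qs| ≤ KL_qs + (κ/(1−κ))·n·Λ̄(2δ(1−κ)/κ)` from an ENTROPY-CONTRACTION coefficient
# `κ` of the layers and the equilibrium log-moment-generating function `Λ̄` of the switch observable —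
# NO sup-norm change-of-reference factor `e^{ΔD/(2n)}`; with a sub-Gaussian `Λ̄ ≤ λ²s²/2` the lag term
# is `(2τ − 1)·s²/n`, `2τ = (2 − κ)/κ` — E7's `2τ_int σ²/n_step` shape

HONEST FRAMING: exact (Metropolis-corrected) sampling algorithms for lattice gauge theory;
figures of merit are autocorrelation/cost numbers at stated couplings and volumes; no
continuum-physics claim.

Venture `LatticeQCDFlow` (cell pub-lqcd), topic `Scaling`; FANOUT row 19 (`su2-snf`, GEN-9: lever
`protocol.n_step`).  OUR WORK (elementary finite sums); nothing is cited as a fact (the Gibbs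
variational inequality is NAMED ONLY and proved for finite laws from the tree's `klFin_nonneg`).  WHY:
the `χ²` lag law of `Scaling/GeneralLayerLagLaw` (GEN-5) propagates `χ²` through the switches at the
price of the factor `e^{|c_{k+1} − c_k|·ΔD/2}` (`ΔD` = oscillation of the defect action), uninformative
at production `n_step` (`ΔD/n ≫ 1`) — GEN-6's open item (d3).  Relative entropy changes reference law
WITHOUT a sup-norm: `KL(μ‖π_{c'}) = KL(μ‖π_c) + (c' − c)·(E_μ D − ⟨D⟩_c) + KL(π_c‖π_{c'})` EXACTLY
(`klFin_changeRef_linAction`), and the lag `E_μ D − ⟨D⟩_c` is controlled by `KL(μ‖π_c)` and the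
equilibrium log-MGF of `D` (`sum_mul_le_klFin_add_log`).

## Setting (row 8 / `Scaling/GeneralLayerDissipation`) and content

Finite `X`, linear protocol `S_c = S₀ + c • D` on a UNIFORM grid `c_{k+1} − c_k = δ > 0`, started in
equilibrium at `c_0`; after the switch `c_k → c_{k+1}` a row-stochastic layer `P_k` targeting
`π_{k+1} = π_{c_{k+1}}` acts; `μ_j` the `j`-th marginal, `a_j = KL(μ_j‖π_j)`,
`lag_j = E_{μ_j}D − ⟨D⟩_{c_j}` (`layerLag`), `KL_qs = qsDissipation = Σ_{j<n} KL(π_j‖π_{j+1})`.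
ENTROPY CONTRACTION of the layers: `KL(μP_k ‖ π_{k+1}) ≤ (1 − κ)·KL(μ ‖ π_{k+1})` for every
probability law `μ` (`0 < κ ≤ 1`; stated inline, no definition).  LOG-MGF ENVELOPE:
`log Σ_y π_j(y) e^{±λ(D y − ⟨D⟩_{c_j})} ≤ Λ` for the levels `j < n`.

* §1 `sum_mul_le_klFin_add_log` (`Σ μ g ≤ KL(μ‖π) + log Σ π e^g`), `klFin_changeRef_linAction`;
* §2 `sum_range_le_of_rec` (`a_0 = 0`, `a_j ≥ 0`, `a_{j+1} ≤ r a_j + s_j`, `r < 1` ⇒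
  `Σ_{j<n} a_j ≤ (Σ_{j<n} s_j)/(1 − r)`);
* §3 `abs_layerLag_le_entropy` (`|lag_j| ≤ (a_j + Λ)/λ`), `klFin_evolveLaw_succ_le` (THE ENTROPY
  RECURSION `a_{j+1} ≤ (1−κ)(a_j + δ·lag_j + KL(π_j‖π_{j+1}))`),
  **`abs_layerDissipation_sub_qs_le_entropy_gen`** — any `λ > 0` with `r = (1−κ)(1 + δ/λ) < 1`:
  `|⟨W⟩ − ΔF − KL_qs| ≤ (δ/λ)·[(1−κ)(KL_qs + n(δ/λ)Λ)/(1 − r) + nΛ]`;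
  **`abs_layerDissipation_sub_qs_le_entropy`** — the choice `λ = 2δ(1−κ)/κ` (`κ < 1`):
  `|⟨W⟩ − ΔF − KL_qs| ≤ KL_qs + (κ/(1−κ))·n·Λ`, hence `⟨W⟩ − ΔF ≤ 2KL_qs + (κ/(1−κ))·n·Λ`
  (`layerDissipation_le_entropy`); `…_entropy'` — the choice `λ = 2δ/κ` (`κ ≤ 1`):
  `|⟨W⟩ − ΔF − KL_qs| ≤ ((1−κ)/(1+κ))·KL_qs + (κ/(1+κ))·n·Λ`.

Reading (value-free): with a sub-Gaussian envelope `Λ ≤ λ²σ̄²/2` at `λ = 2δ(1−κ)/κ` the lag term is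
`(κ/(1−κ))·n·2δ²(1−κ)²σ̄²/κ² = 2nδ²σ̄²(1−κ)/κ` — for the unit span `nδ = 1`: `(2τ − 1)σ̄²/n` with
`2τ = (2−κ)/κ`, the `2τ_int·σ̄²/n_step` scale of E7 / row 19's AR(1) dictionary (`Scaling/AR1SwitchingLaw`:
`2τ_int = (1+ρ)/(1−ρ)`, `ρ = 1 − κ`), now WITHOUT `e^{ΔD/(2n)}` (row 8's exactly solved lazy layers:
`(1−κ)σ²/(nκ)`-type, a factor `2` below the envelope); with only `|D x − D y| ≤ ΔD` (Hoeffding,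
`Λ ≤ λ²ΔD²/8`) it is `ΔD²(1−κ)/(2nκ)` — polynomial, never exponential, in `ΔD/n` (on a 3-state
toy: loose, ×40–100 vs ×7–12 for the `χ²` law at `ΔD/n ≪ 1`, but finite where that law is not).  Entropy contraction with `κ = ε` follows from a Doeblin minorisation
`P_k(x, ·) ≥ ε·π_{k+1}` (convexity + data processing; sequel `Scaling/EntropyLagLawDoeblin`), with
`κ = 1 − ε` for row 8's lazy layers, `κ = 1` for perfect relaxation.  NOT CLAIMED: `κ` or `Λ` for any
lattice kernel; a spectral gap alone does NOT give entropy contraction (that needs a log-Sobolev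
constant); anything numerical.
-/

namespace Summit.Ventures.LatticeQCDFlow.Scaling

open Finset
open Literature.Probability.MarkovChains (IsRowStochastic stepLaw stepLaw_nonneg sum_stepLaw)
open Summit.Ventures.LatticeQCDFlow.Exactness
open Summit.Ventures.LatticeQCDFlow.Theory2

variable {X : Type*} [Fintype X]

/-! ## §1 Two relative-entropy identities / inequalities for finite laws -/

/-- `m·log(m/(a·b)) = m·log(m/a) − m·log b` for `m ≥ 0`, `a, b > 0` (both sides vanish at `m = 0`). -/
theorem mul_log_div_mul_eq {m a b : ℝ} (hm : 0 ≤ m) (ha : 0 < a) (hb : 0 < b) :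
    m * Real.log (m / (a * b)) = m * Real.log (m / a) - m * Real.log b := by
  rcases eq_or_lt_of_le hm with h | h
  · rw [← h]; simp
  · rw [Real.log_div h.ne' (mul_pos ha hb).ne', Real.log_mul ha.ne' hb.ne', Real.log_div h.ne' ha.ne']
    ring

/-- **The Gibbs variational (Donsker–Varadhan) inequality for finite laws**: for a probability law
`μ ≥ 0` and positive weights `π`, `Σ_x μ(x) g(x) ≤ KL(μ‖π) + log Σ_x π(x) e^{g(x)}` for every `g` —
from `KL(μ ‖ π e^g/Z) ≥ 0`, `Z = Σ π e^g`. [folklore; ours] -/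
theorem sum_mul_le_klFin_add_log [Nonempty X] {μ π : X → ℝ} (hμ : ∀ x, 0 ≤ μ x)
    (hμ1 : ∑ x, μ x = 1) (hπ : ∀ x, 0 < π x) (g : X → ℝ) :
    ∑ x, μ x * g x ≤ klFin μ π + Real.log (∑ x, π x * Real.exp (g x)) := by
  set Z := ∑ x, π x * Real.exp (g x) with hZ
  have hZpos : 0 < Z := sum_pos (fun x _ => mul_pos (hπ x) (Real.exp_pos _)) univ_nonempty
  set ν : X → ℝ := fun x => π x * (Real.exp (g x) / Z) with hν
  have hνpos : ∀ x, 0 < ν x := fun x => mul_pos (hπ x) (div_pos (Real.exp_pos _) hZpos)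
  have hν1 : ∑ x, ν x = 1 := by
    simp only [hν, mul_div_assoc']
    rw [← sum_div, div_self hZpos.ne']
  have hkl := klFin_nonneg hμ hνpos (by rw [hμ1, hν1])
  -- `KL(μ‖ν) = KL(μ‖π) − Σ μ g + log Z`
  have hsplit : klFin μ ν = klFin μ π - ∑ x, μ x * g x + Real.log Z := by
    unfold klFin
    have hterm : ∀ x, μ x * Real.log (μ x / ν x)
        = μ x * Real.log (μ x / π x) - μ x * g x + μ x * Real.log Z := by
      intro x
      simp only [hν]
      rw [mul_log_div_mul_eq (hμ x) (hπ x) (div_pos (Real.exp_pos _) hZpos),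
        Real.log_div (Real.exp_pos _).ne' hZpos.ne', Real.log_exp]
      ring
    simp_rw [hterm]
    rw [sum_add_distrib, sum_sub_distrib, ← sum_mul, hμ1, one_mul]
  linarith

/-- `log π_c(x) = −(S₀ x + c·D x) + F_c` for the Gibbs law of the linear family
(`F_c = linFreeEnergy = −log Z_c`). -/
theorem log_gibbsLaw_linAction [Nonempty X] (S₀ D : X → ℝ) (c : ℝ) (x : X) :
    Real.log (gibbsLaw (linAction S₀ D c) x) = -(S₀ x + c * D x) + linFreeEnergy S₀ D c := by
  unfold gibbsLaw linFreeEnergy freeEnergy linAction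
  rw [Real.log_div (Real.exp_pos _).ne' (partitionFn_pos _).ne', Real.log_exp]
  ring

/-- **Change of reference law along the linear family, EXACTLY (no sup-norm):**
`KL(μ ‖ π_b) = KL(μ ‖ π_a) + (b − a)·(E_μ D − ⟨D⟩_a) + KL(π_a ‖ π_b)` for every probability law
`μ ≥ 0`. [ours] -/
theorem klFin_changeRef_linAction [Nonempty X] (S₀ D : X → ℝ) (a b : ℝ) {μ : X → ℝ}
    (hμ : ∀ x, 0 ≤ μ x) (hμ1 : ∑ x, μ x = 1) :
    klFin μ (gibbsLaw (linAction S₀ D b))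
      = klFin μ (gibbsLaw (linAction S₀ D a)) + (b - a) * (∑ x, μ x * D x - meanD S₀ D a)
        + klFin (gibbsLaw (linAction S₀ D a)) (gibbsLaw (linAction S₀ D b)) := by
  rw [klFin_gibbsLaw_linAction]
  have hterm : ∀ x, μ x * Real.log (μ x / gibbsLaw (linAction S₀ D b) x)
      = μ x * Real.log (μ x / gibbsLaw (linAction S₀ D a) x)
        + μ x * ((b - a) * D x + (linFreeEnergy S₀ D a - linFreeEnergy S₀ D b)) := by
    intro x
    have hpa := gibbsLaw_pos (linAction S₀ D a) x
    have hpb := gibbsLaw_pos (linAction S₀ D b) x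
    rcases eq_or_lt_of_le (hμ x) with h | h
    · rw [← h]; simp
    · rw [Real.log_div h.ne' hpb.ne', Real.log_div h.ne' hpa.ne', log_gibbsLaw_linAction,
        log_gibbsLaw_linAction]
      ring
  unfold klFin
  simp_rw [hterm]
  rw [sum_add_distrib]
  have hlin : ∑ x, μ x * ((b - a) * D x + (linFreeEnergy S₀ D a - linFreeEnergy S₀ D b))
      = (b - a) * ∑ x, μ x * D x + (linFreeEnergy S₀ D a - linFreeEnergy S₀ D b) := by
    simp only [mul_add, sum_add_distrib, ← sum_mul, hμ1, one_mul]
    rw [mul_sum]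
    congr 1
    exact sum_congr rfl fun x _ => by ring
  rw [hlin]
  ring

/-! ## §2 A linear recursion -/

/-- If `a_0 = 0`, `a_j ≥ 0` and `a_{j+1} ≤ r·a_j + s_j` for `j < n`, with `r < 1`, then
`Σ_{j<n} a_j ≤ (Σ_{j<n} s_j)/(1 − r)`. [ours] -/
theorem sum_range_le_of_rec {a s : ℕ → ℝ} {r : ℝ} (hr1 : r < 1) (ha0 : a 0 = 0)
    (han : ∀ j, 0 ≤ a j) (n : ℕ) (hrec : ∀ j, j < n → a (j + 1) ≤ r * a j + s j) :
    ∑ j ∈ range n, a j ≤ (∑ j ∈ range n, s j) / (1 - r) := by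
  have hshift : ∑ j ∈ range n, a (j + 1) = ∑ j ∈ range n, a j + a n - a 0 := by
    linarith [sum_range_succ a n, sum_range_succ' a n]
  have hstep : ∑ j ∈ range n, a (j + 1) ≤ r * ∑ j ∈ range n, a j + ∑ j ∈ range n, s j := by
    rw [mul_sum, ← sum_add_distrib]
    exact sum_le_sum fun j hj => hrec j (mem_range.1 hj)
  rw [le_div_iff₀ (by linarith)]
  have := han n
  nlinarith

/-! ## §3 The entropy route to the lag law -/

section Law

variable [Nonempty X] (S₀ D : X → ℝ) (c : ℕ → ℝ) (P : ℕ → X → X → ℝ)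

/-- The marginals are non-negative … -/
theorem evolveLaw_nonneg (hP : ∀ k, IsRowStochastic (P k)) :
    ∀ j x, 0 ≤ evolveLaw P (gibbsLaw (linAction S₀ D (c 0))) j x
  | 0, x => (gibbsLaw_pos _ x).le
  | j + 1, x => by rw [evolveLaw_succ]; exact stepLaw_nonneg (hP j) (evolveLaw_nonneg hP j) x

/-- … probability laws. -/
theorem sum_evolveLaw_gibbs (hP : ∀ k, IsRowStochastic (P k)) (j : ℕ) :
    ∑ x, evolveLaw P (gibbsLaw (linAction S₀ D (c 0))) j x = 1 := by
  rw [sum_evolveLaw P (fun k => (hP k).2) _ j, sum_gibbsLaw]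

/-- **The lag is controlled by relative entropy and the equilibrium log-MGF**: for `λ > 0` and
`Λ` bounding `log Σ_y π_j(y) e^{±λ(D y − ⟨D⟩_{c_j})}`,
`|lag_j| ≤ (KL(μ_j ‖ π_j) + Λ)/λ`. [ours] -/
theorem abs_layerLag_le_entropy (hP : ∀ k, IsRowStochastic (P k)) {lam Λ : ℝ} (hlam : 0 < lam)
    (j : ℕ)
    (hΛp : Real.log (∑ y, gibbsLaw (linAction S₀ D (c j)) y
        * Real.exp (lam * (D y - meanD S₀ D (c j)))) ≤ Λ)
    (hΛm : Real.log (∑ y, gibbsLaw (linAction S₀ D (c j)) y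
        * Real.exp (-lam * (D y - meanD S₀ D (c j)))) ≤ Λ) :
    |layerLag S₀ D c P j|
      ≤ (klFin (evolveLaw P (gibbsLaw (linAction S₀ D (c 0))) j) (gibbsLaw (linAction S₀ D (c j)))
          + Λ) / lam := by
  have hμ0 := evolveLaw_nonneg S₀ D c P hP j
  have hμ1 := sum_evolveLaw_gibbs S₀ D c P hP j
  have hπ0 : ∀ x, 0 < gibbsLaw (linAction S₀ D (c j)) x := gibbsLaw_pos _
  -- `Σ μ (t (D − m)) = t · lag`
  have hlin : ∀ t : ℝ, ∑ x, evolveLaw P (gibbsLaw (linAction S₀ D (c 0))) j x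
      * (t * (D x - meanD S₀ D (c j))) = t * layerLag S₀ D c P j := by
    intro t
    unfold layerLag
    have hx : ∀ x, evolveLaw P (gibbsLaw (linAction S₀ D (c 0))) j x * (t * (D x - meanD S₀ D (c j)))
        = t * (evolveLaw P (gibbsLaw (linAction S₀ D (c 0))) j x * D x)
          - (t * meanD S₀ D (c j)) * evolveLaw P (gibbsLaw (linAction S₀ D (c 0))) j x := by
      intro x; ring
    rw [sum_congr rfl (fun x _ => hx x), sum_sub_distrib, ← mul_sum, ← mul_sum, hμ1]
    ring
  have hp := sum_mul_le_klFin_add_log hμ0 hμ1 hπ0 (fun x => lam * (D x - meanD S₀ D (c j)))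
  have hm := sum_mul_le_klFin_add_log hμ0 hμ1 hπ0 (fun x => -lam * (D x - meanD S₀ D (c j)))
  rw [hlin] at hp hm
  rw [abs_le]
  constructor
  · rw [neg_le, le_div_iff₀ hlam]; linarith
  · rw [le_div_iff₀ hlam]; linarith

/-- **THE ENTROPY RECURSION.**  With entropy contraction `κ` of `P_j` towards `π_{j+1}` and the
uniform grid `c_{j+1} − c_j = δ`:
`KL(μ_{j+1} ‖ π_{j+1}) ≤ (1 − κ)·(KL(μ_j ‖ π_j) + δ·lag_j + KL(π_j ‖ π_{j+1}))`. [ours] -/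
theorem klFin_evolveLaw_succ_le (hP : ∀ k, IsRowStochastic (P k)) {δ : ℝ}
    (hc : ∀ k, c (k + 1) - c k = δ) {κ : ℝ}
    (hK : ∀ k (μ : X → ℝ), (∀ x, 0 ≤ μ x) → ∑ x, μ x = 1 →
      klFin (stepLaw (P k) μ) (gibbsLaw (linAction S₀ D (c (k + 1))))
        ≤ (1 - κ) * klFin μ (gibbsLaw (linAction S₀ D (c (k + 1))))) (j : ℕ) :
    klFin (evolveLaw P (gibbsLaw (linAction S₀ D (c 0))) (j + 1))
        (gibbsLaw (linAction S₀ D (c (j + 1))))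
      ≤ (1 - κ) * (klFin (evolveLaw P (gibbsLaw (linAction S₀ D (c 0))) j)
            (gibbsLaw (linAction S₀ D (c j)))
          + δ * layerLag S₀ D c P j
          + klFin (gibbsLaw (linAction S₀ D (c j))) (gibbsLaw (linAction S₀ D (c (j + 1))))) := by
  have hμ0 := evolveLaw_nonneg S₀ D c P hP j
  have hμ1 := sum_evolveLaw_gibbs S₀ D c P hP j
  rw [evolveLaw_succ]
  refine (hK j _ hμ0 hμ1).trans (le_of_eq ?_)
  rw [klFin_changeRef_linAction S₀ D (c j) (c (j + 1)) hμ0 hμ1, hc j]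
  rfl

/-- **THE ENTROPY LAG LAW, general `λ`.**  Row-stochastic layers with entropy contraction
`0 < κ ≤ 1` towards their targets, uniform grid `c_{k+1} − c_k = δ > 0`, log-MGF envelope `Λ` at `±λ`
(`λ > 0`) for every level, and `r = (1 − κ)(1 + δ/λ) < 1`.  Then for every `n`:
`|⟨W⟩ − ΔF − KL_qs| ≤ (δ/λ)·((1 − κ)(KL_qs + n(δ/λ)Λ)/(1 − r) + nΛ)`. [ours] -/
theorem abs_layerDissipation_sub_qs_le_entropy_gen (hP : ∀ k, IsRowStochastic (P k)) {δ : ℝ}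
    (hδ : 0 < δ) (hc : ∀ k, c (k + 1) - c k = δ) {κ : ℝ} (hκ1 : κ ≤ 1)
    (hK : ∀ k (μ : X → ℝ), (∀ x, 0 ≤ μ x) → ∑ x, μ x = 1 →
      klFin (stepLaw (P k) μ) (gibbsLaw (linAction S₀ D (c (k + 1))))
        ≤ (1 - κ) * klFin μ (gibbsLaw (linAction S₀ D (c (k + 1)))))
    {lam Λ : ℝ} (hlam : 0 < lam) (hr : (1 - κ) * (1 + δ / lam) < 1) (n : ℕ)
    (hΛp : ∀ j, j < n → Real.log (∑ y, gibbsLaw (linAction S₀ D (c j)) y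
        * Real.exp (lam * (D y - meanD S₀ D (c j)))) ≤ Λ)
    (hΛm : ∀ j, j < n → Real.log (∑ y, gibbsLaw (linAction S₀ D (c j)) y
        * Real.exp (-lam * (D y - meanD S₀ D (c j)))) ≤ Λ) :
    |layerDissipation S₀ D c P n - qsDissipation S₀ D c n|
      ≤ (δ / lam) * ((1 - κ) * (qsDissipation S₀ D c n + n * (δ / lam) * Λ)
            / (1 - (1 - κ) * (1 + δ / lam)) + n * Λ) := by
  -- notation
  set a : ℕ → ℝ := fun j => klFin (evolveLaw P (gibbsLaw (linAction S₀ D (c 0))) j)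
    (gibbsLaw (linAction S₀ D (c j))) with ha
  set q : ℕ → ℝ := fun j => klFin (gibbsLaw (linAction S₀ D (c j)))
    (gibbsLaw (linAction S₀ D (c (j + 1)))) with hq
  set u := δ / lam with hu
  have hu0 : 0 < u := div_pos hδ hlam
  have hκ' : 0 ≤ 1 - κ := sub_nonneg.2 hκ1
  -- the per-step facts
  have han : ∀ j, 0 ≤ a j := fun j =>
    klFin_nonneg (evolveLaw_nonneg S₀ D c P hP j) (gibbsLaw_pos _)
      (by rw [sum_evolveLaw_gibbs S₀ D c P hP j, sum_gibbsLaw])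
  have ha0 : a 0 = 0 := by
    simp only [ha, evolveLaw_zero]
    exact klFin_self (gibbsLaw_pos _)
  have hlag : ∀ j, j < n → |layerLag S₀ D c P j| ≤ (a j + Λ) / lam := fun j hj =>
    abs_layerLag_le_entropy S₀ D c P hP hlam j (hΛp j hj) (hΛm j hj)
  have hrec : ∀ j, j < n → a (j + 1) ≤ (1 - κ) * (1 + u) * a j + (1 - κ) * (q j + u * Λ) := by
    intro j hj
    have h1 := klFin_evolveLaw_succ_le S₀ D c P hP hc hK j
    have h2 : δ * layerLag S₀ D c P j ≤ u * (a j + Λ) := by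
      have := (abs_le.1 (hlag j hj)).2
      calc δ * layerLag S₀ D c P j ≤ δ * ((a j + Λ) / lam) :=
            mul_le_mul_of_nonneg_left this hδ.le
        _ = u * (a j + Λ) := by rw [hu]; ring
    calc a (j + 1) ≤ (1 - κ) * (a j + δ * layerLag S₀ D c P j + q j) := h1
      _ ≤ (1 - κ) * (a j + u * (a j + Λ) + q j) := by
          apply mul_le_mul_of_nonneg_left _ hκ'
          linarith
      _ = (1 - κ) * (1 + u) * a j + (1 - κ) * (q j + u * Λ) := by ring
  -- sum of the entropies
  have hsumA : ∑ j ∈ range n, a j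
      ≤ (∑ j ∈ range n, (1 - κ) * (q j + u * Λ)) / (1 - (1 - κ) * (1 + u)) :=
    sum_range_le_of_rec hr ha0 han n hrec
  have hsumq : ∑ j ∈ range n, q j = qsDissipation S₀ D c n :=
    (qsDissipation_eq_sum_klFin S₀ D c n).symm
  have hsums : ∑ j ∈ range n, (1 - κ) * (q j + u * Λ)
      = (1 - κ) * (qsDissipation S₀ D c n + n * u * Λ) := by
    rw [← mul_sum, sum_add_distrib, hsumq, sum_const, card_range, nsmul_eq_mul]
    ring
  rw [hsums] at hsumA
  -- the lag sum
  have hdiss : layerDissipation S₀ D c P n - qsDissipation S₀ D c n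
      = ∑ j ∈ range n, δ * layerLag S₀ D c P j := by
    rw [layerDissipation_eq S₀ D c P (fun k => (hP k).2) n, add_sub_cancel_left]
    exact sum_congr rfl fun j _ => by rw [hc j]
  rw [hdiss]
  calc |∑ j ∈ range n, δ * layerLag S₀ D c P j|
      ≤ ∑ j ∈ range n, |δ * layerLag S₀ D c P j| := abs_sum_le_sum_abs _ _
    _ ≤ ∑ j ∈ range n, u * (a j + Λ) := by
        refine sum_le_sum fun j hj => ?_
        rw [abs_mul, abs_of_pos hδ]
        calc δ * |layerLag S₀ D c P j| ≤ δ * ((a j + Λ) / lam) :=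
              mul_le_mul_of_nonneg_left (hlag j (mem_range.1 hj)) hδ.le
          _ = u * (a j + Λ) := by rw [hu]; ring
    _ = u * (∑ j ∈ range n, a j + n * Λ) := by
        rw [← mul_sum, sum_add_distrib, sum_const, card_range, nsmul_eq_mul]
    _ ≤ u * ((1 - κ) * (qsDissipation S₀ D c n + n * u * Λ) / (1 - (1 - κ) * (1 + u))
          + n * Λ) := by
        apply mul_le_mul_of_nonneg_left _ hu0.le
        linarith

/-- **THE ENTROPY LAG LAW** (the choice `λ = 2δ(1−κ)/κ`, optimal for the log-MGF term).
Row-stochastic layers with entropy contraction `0 < κ < 1` towards their targets, uniform grid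
`c_{k+1} − c_k = δ > 0`, and `Λ` bounding the equilibrium log-MGFs
`log Σ_y π_j(y) e^{±λ(D y − ⟨D⟩_{c_j})}` at `λ = 2δ(1−κ)/κ` for the levels `j < n`.  Then for every `n`:
`|⟨W⟩ − ΔF − KL_qs| ≤ KL_qs + (κ/(1 − κ))·n·Λ` — no oscillation / sup-norm factor; with a sub-Gaussian
envelope `Λ ≤ λ²s²/2` the lag term is `2nδ²s²·(1 − κ)/κ` (unit span `nδ = 1`: `(2τ − 1)·s²/n` with
`2τ = (2 − κ)/κ` the AR(1) integrated autocorrelation time of a layer of autocorrelation `1 − κ` — E7 /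
`Scaling/AR1SwitchingLaw`'s dictionary, as an upper envelope up to `KL_qs`). [ours] -/
theorem abs_layerDissipation_sub_qs_le_entropy (hP : ∀ k, IsRowStochastic (P k)) {δ : ℝ}
    (hδ : 0 < δ) (hc : ∀ k, c (k + 1) - c k = δ) {κ : ℝ} (hκ0 : 0 < κ) (hκ1 : κ < 1)
    (hK : ∀ k (μ : X → ℝ), (∀ x, 0 ≤ μ x) → ∑ x, μ x = 1 →
      klFin (stepLaw (P k) μ) (gibbsLaw (linAction S₀ D (c (k + 1))))
        ≤ (1 - κ) * klFin μ (gibbsLaw (linAction S₀ D (c (k + 1)))))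
    {Λ : ℝ} (n : ℕ)
    (hΛp : ∀ j, j < n → Real.log (∑ y, gibbsLaw (linAction S₀ D (c j)) y
        * Real.exp ((2 * δ * (1 - κ) / κ) * (D y - meanD S₀ D (c j)))) ≤ Λ)
    (hΛm : ∀ j, j < n → Real.log (∑ y, gibbsLaw (linAction S₀ D (c j)) y
        * Real.exp (-(2 * δ * (1 - κ) / κ) * (D y - meanD S₀ D (c j)))) ≤ Λ) :
    |layerDissipation S₀ D c P n - qsDissipation S₀ D c n|
      ≤ qsDissipation S₀ D c n + κ / (1 - κ) * n * Λ := by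
  have h1κ : 0 < 1 - κ := sub_pos.2 hκ1
  have hlam : 0 < 2 * δ * (1 - κ) / κ := div_pos (by positivity) hκ0
  have hu : δ / (2 * δ * (1 - κ) / κ) = κ / (2 * (1 - κ)) := by
    field_simp
  have hr : (1 - κ) * (1 + δ / (2 * δ * (1 - κ) / κ)) < 1 := by
    rw [hu]
    have : (1 - κ) * (1 + κ / (2 * (1 - κ))) = 1 - κ / 2 := by field_simp; ring
    rw [this]; linarith
  have key := abs_layerDissipation_sub_qs_le_entropy_gen S₀ D c P hP hδ hc hκ1.le hK hlam hr n
    hΛp hΛm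
  rw [hu] at key
  have hden : 1 - (1 - κ) * (1 + κ / (2 * (1 - κ))) = κ / 2 := by field_simp; ring
  rw [hden] at key
  refine key.trans (le_of_eq ?_)
  field_simp
  ring

/-- **One-sided form**: `⟨W⟩ − ΔF ≤ 2·KL_qs + (κ/(1 − κ))·n·Λ` (`λ = 2δ(1−κ)/κ`). [ours] -/
theorem layerDissipation_le_entropy (hP : ∀ k, IsRowStochastic (P k)) {δ : ℝ}
    (hδ : 0 < δ) (hc : ∀ k, c (k + 1) - c k = δ) {κ : ℝ} (hκ0 : 0 < κ) (hκ1 : κ < 1)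
    (hK : ∀ k (μ : X → ℝ), (∀ x, 0 ≤ μ x) → ∑ x, μ x = 1 →
      klFin (stepLaw (P k) μ) (gibbsLaw (linAction S₀ D (c (k + 1))))
        ≤ (1 - κ) * klFin μ (gibbsLaw (linAction S₀ D (c (k + 1)))))
    {Λ : ℝ} (n : ℕ)
    (hΛp : ∀ j, j < n → Real.log (∑ y, gibbsLaw (linAction S₀ D (c j)) y
        * Real.exp ((2 * δ * (1 - κ) / κ) * (D y - meanD S₀ D (c j)))) ≤ Λ)
    (hΛm : ∀ j, j < n → Real.log (∑ y, gibbsLaw (linAction S₀ D (c j)) y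
        * Real.exp (-(2 * δ * (1 - κ) / κ) * (D y - meanD S₀ D (c j)))) ≤ Λ) :
    layerDissipation S₀ D c P n ≤ 2 * qsDissipation S₀ D c n + κ / (1 - κ) * n * Λ := by
  have key := abs_layerDissipation_sub_qs_le_entropy S₀ D c P hP hδ hc hκ0 hκ1 hK n hΛp hΛm
  have h1 := (abs_le.1 key).2
  linarith

/-- **THE ENTROPY LAG LAW, second packaging** (the choice `λ = 2δ/κ`, valid up to `κ = 1`): with `Λ`
bounding the log-MGFs at `λ = 2δ/κ`,
`|⟨W⟩ − ΔF − KL_qs| ≤ ((1 − κ)/(1 + κ))·KL_qs + (κ/(1 + κ))·n·Λ`. [ours] -/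
theorem abs_layerDissipation_sub_qs_le_entropy' (hP : ∀ k, IsRowStochastic (P k)) {δ : ℝ}
    (hδ : 0 < δ) (hc : ∀ k, c (k + 1) - c k = δ) {κ : ℝ} (hκ0 : 0 < κ) (hκ1 : κ ≤ 1)
    (hK : ∀ k (μ : X → ℝ), (∀ x, 0 ≤ μ x) → ∑ x, μ x = 1 →
      klFin (stepLaw (P k) μ) (gibbsLaw (linAction S₀ D (c (k + 1))))
        ≤ (1 - κ) * klFin μ (gibbsLaw (linAction S₀ D (c (k + 1)))))
    {Λ : ℝ} (n : ℕ)
    (hΛp : ∀ j, j < n → Real.log (∑ y, gibbsLaw (linAction S₀ D (c j)) y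
        * Real.exp ((2 * δ / κ) * (D y - meanD S₀ D (c j)))) ≤ Λ)
    (hΛm : ∀ j, j < n → Real.log (∑ y, gibbsLaw (linAction S₀ D (c j)) y
        * Real.exp (-(2 * δ / κ) * (D y - meanD S₀ D (c j)))) ≤ Λ) :
    |layerDissipation S₀ D c P n - qsDissipation S₀ D c n|
      ≤ (1 - κ) / (1 + κ) * qsDissipation S₀ D c n + κ / (1 + κ) * n * Λ := by
  have hlam : 0 < 2 * δ / κ := div_pos (by linarith) hκ0
  have hu : δ / (2 * δ / κ) = κ / 2 := by field_simp
  have hr : (1 - κ) * (1 + δ / (2 * δ / κ)) < 1 := by rw [hu]; nlinarith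
  have key := abs_layerDissipation_sub_qs_le_entropy_gen S₀ D c P hP hδ hc hκ1 hK hlam hr n hΛp hΛm
  rw [hu] at key
  have hden : 1 - (1 - κ) * (1 + κ / 2) = κ * (1 + κ) / 2 := by ring
  rw [hden] at key
  refine key.trans (le_of_eq ?_)
  field_simp
  ring

end Law

end Summit.Ventures.LatticeQCDFlow.Scaling
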